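import Summits.NavierStokesRegularity.NavierStokesRegularity.Theorems.TypeIQuantSubcubicExp.Negative.ThinCascadeLiouvilleImpliesFDL
import Summits.NavierStokesRegularity.NavierStokesRegularity.Theorems.LerayQuarterDissipationFiniteDissipationLiouvilleHardness
import HarnessLib

/-!
# Stub S3 `stub_thinCascadeLiouville` of crux `TypeIQuantSubcubicExp` (stmt-NavierStokesRegularity-24077,
# line `thin_cascade`): HARDNESS CERTIFICATE — S3 implies the catalogued Type-I DSS Liouville
# conjecture, and every Type-I (rotated) DSS profile IS a thin object

Refuter-side negative-lane file (seat ns-afl-r1 g6, `--supports stmt-NavierStokesRegularity-24077`),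
companion of `…Negative.ThinCascadeLiouvilleImpliesFDL` (S3 ⇒ `FiniteDissipationLiouville`) and of
LQD's hardness file `…FiniteDissipationLiouvilleHardness` (`FiniteDissipationLiouville` ⇒ the
`@[conjecture]` leaf `TypeIDSSLiouvilleConjecture`, Bradshaw–Tsai 2017 Open Problem 5.1 / Tsai
Conjectures 8.8–8.9, plain and rotated, every factor `λ`).  Navier–Stokes regularity is NOT proved by
anything here; no summit statement is; S3, 24077 and the conjecture leaf stay OPEN.

* `typeIDSSLiouvilleConjecture_of_thinCascadeLiouville` — **S3 ⇒ `TypeIDSSLiouvilleConjecture`**: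
  the one open stub of the line is at least as hard as the sub-problem's catalogued conjecture leaf
  (composition of the two landed edges);
* `typeIDSSLiouville_of_thinCascadeLiouville`, `rotatedTypeIDSSLiouville_of_thinCascadeLiouville` —
  the plain / rotated `λ`-DSS forms;
* `exists_thinObject_of_isTypeIDSSProfile` — **THE INSTRUMENT DICTIONARY AS A THEOREM**: any Type-I
  (rotated) discretely self-similar profile `IsTypeIDSSProfile c R u` (ancient mild, rotated `c`-DSS
  with `c > 1`, envelope `|u| ≤ C₀/(|x|+√(−t))`, not a.e. zero, smooth on the open past) yields a
  thin singular Type-I object `ThinObject M q v g` — no trace hypothesis, no thin-budget hypothesis,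
  no finite-dissipation hypothesis on the candidate: all three are consequences (LQD's
  `not_finiteDissipationLiouville_of_isTypeIDSSProfile` puts the smooth representative in a stratum
  `𝒟_{C,K}`, and `exists_thinObject_of_not_finiteDissipationLiouville` extracts the critical element
  with its final datum);
* `not_thinCascadeLiouville_of_isTypeIDSSProfile` — so a converged backward (R)DSS Type-I blow-up
  profile (the rows of the DSS instrument, pub/ideators/ns-afl-r1/SPEC-DSS-INSTRUMENT-v1.md) REFUTES S3
  outright.  It does NOT refute the crux 24077 itself (a statement about finite-energy smooth
  solutions on `[0,T]`), only the registered line through S3.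

Refuter reading (numbers, not adjectives): the S3 verdict table's admissible refutation objects are
exactly the objects of `TypeIDSSLiouvilleConjecture`'s negation plus every singular member of every
finite-dissipation stratum; the current count of converged candidates is 0 (VERDICT-TABLES-DSS-v1,
0/9 rows resident).  No definitions; standard axioms.
-/

noncomputable section

-- the summit and its single sub-problem share the name (CONVENTIONS §1), as in every Theorems file
set_option linter.dupNamespace false

namespace Summit.NavierStokesRegularity.NavierStokesRegularity.Theorems.TypeIQuantSubcubicExp.Negative

open MeasureTheory Set Filter Topology Metric Function
open Literature.Analysis Literature.Analysis.FluidPDE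
open Summit.NavierStokesRegularity.NavierStokesRegularity.Theorems
open Summit.NavierStokesRegularity.NavierStokesRegularity.Theorems.FiniteDissipationLiouville
open Summit.NavierStokesRegularity.NavierStokesRegularity.Cruxes.TypeIQuantSubcubicExp.ThinCascade
  (ThinObject)
open scoped ENNReal NNReal

/-- **S3 ⇒ the catalogued Type-I DSS Liouville conjecture** (`@[conjecture]` leaf
`TypeIDSSLiouvilleConjecture`: plain and rotated `λ`-DSS, every `λ`): the thin-cascade Liouville
statement is at least as hard as Bradshaw–Tsai OP 5.1. CONDITIONAL on S3 (hypothesis only).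
[cite: BradshawTsai2017CPDE, §5 Open Problem 5.1] -/
theorem typeIDSSLiouvilleConjecture_of_thinCascadeLiouville
    (hS3 : ∀ (M q : ℝ) (v : ℝ → EuclideanSpace ℝ (Fin 3) → EuclideanSpace ℝ (Fin 3))
      (g : EuclideanSpace ℝ (Fin 3) → EuclideanSpace ℝ (Fin 3)), ¬ ThinObject M q v g) :
    _root_.Summit.NavierStokesRegularity.NavierStokesRegularity.TypeIDSSLiouvilleConjecture :=
  Hardness.typeIDSSLiouvilleConjecture_of_finiteDissipationLiouville
    (finiteDissipationLiouville_of_thinCascadeLiouville hS3)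

/-- **S3 ⇒ the plain Type-I `λ`-DSS Liouville statement**, every factor `c`. [cite: BradshawTsai2017CPDE, §5 Open Problem 5.1] -/
theorem typeIDSSLiouville_of_thinCascadeLiouville
    (hS3 : ∀ (M q : ℝ) (v : ℝ → EuclideanSpace ℝ (Fin 3) → EuclideanSpace ℝ (Fin 3))
      (g : EuclideanSpace ℝ (Fin 3) → EuclideanSpace ℝ (Fin 3)), ¬ ThinObject M q v g) (c : ℝ) :
    TypeIDSSLiouville c :=
  Hardness.typeIDSSLiouville_of_finiteDissipationLiouville
    (finiteDissipationLiouville_of_thinCascadeLiouville hS3) c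

/-- **S3 ⇒ the rotated Type-I `λ`-DSS Liouville statement**, every factor `c` and rotation `R`.
[cite: BradshawTsai2017CPDE, §5 Open Problem 5.1] -/
theorem rotatedTypeIDSSLiouville_of_thinCascadeLiouville
    (hS3 : ∀ (M q : ℝ) (v : ℝ → EuclideanSpace ℝ (Fin 3) → EuclideanSpace ℝ (Fin 3))
      (g : EuclideanSpace ℝ (Fin 3) → EuclideanSpace ℝ (Fin 3)), ¬ ThinObject M q v g) (c : ℝ)
    (R : EuclideanSpace ℝ (Fin 3) ≃ₗᵢ[ℝ] EuclideanSpace ℝ (Fin 3)) :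
    RotatedTypeIDSSLiouville c R :=
  Hardness.rotatedTypeIDSSLiouville_of_finiteDissipationLiouville
    (finiteDissipationLiouville_of_thinCascadeLiouville hS3) c R

/-- **The instrument dictionary as a theorem: every Type-I (rotated) DSS profile is a thin singular
Type-I object.** From `IsTypeIDSSProfile c R u` some `ThinObject M q v g` exists (`v` the critical
element of the stratum containing the smooth representative of `u`, `g` its final datum); no trace,
budget or dissipation hypothesis on `u` is needed. [folklore] -/
theorem exists_thinObject_of_isTypeIDSSProfile {c : ℝ}
    {R : EuclideanSpace ℝ (Fin 3) ≃ₗᵢ[ℝ] EuclideanSpace ℝ (Fin 3)}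
    {u : ℝ → EuclideanSpace ℝ (Fin 3) → EuclideanSpace ℝ (Fin 3)} (h : IsTypeIDSSProfile c R u) :
    ∃ (M q : ℝ) (v : ℝ → EuclideanSpace ℝ (Fin 3) → EuclideanSpace ℝ (Fin 3))
      (g : EuclideanSpace ℝ (Fin 3) → EuclideanSpace ℝ (Fin 3)), ThinObject M q v g :=
  exists_thinObject_of_not_finiteDissipationLiouville
    (Hardness.not_finiteDissipationLiouville_of_isTypeIDSSProfile h)

/-- **A Type-I (rotated) DSS profile refutes S3** (the registered signature of
`stub_thinCascadeLiouville`, negated). [folklore] -/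
theorem not_thinCascadeLiouville_of_isTypeIDSSProfile {c : ℝ}
    {R : EuclideanSpace ℝ (Fin 3) ≃ₗᵢ[ℝ] EuclideanSpace ℝ (Fin 3)}
    {u : ℝ → EuclideanSpace ℝ (Fin 3) → EuclideanSpace ℝ (Fin 3)} (h : IsTypeIDSSProfile c R u) :
    ¬ (∀ (M q : ℝ) (v : ℝ → EuclideanSpace ℝ (Fin 3) → EuclideanSpace ℝ (Fin 3))
      (g : EuclideanSpace ℝ (Fin 3) → EuclideanSpace ℝ (Fin 3)), ¬ ThinObject M q v g) := by
  intro hS3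
  obtain ⟨M, q, v, g, hthin⟩ := exists_thinObject_of_isTypeIDSSProfile h
  exact hS3 M q v g hthin

/-- **A failure of the conjecture leaf refutes S3** (contrapositive of
`typeIDSSLiouvilleConjecture_of_thinCascadeLiouville`, for the disprover's ledger). [folklore] -/
theorem not_thinCascadeLiouville_of_not_typeIDSSLiouvilleConjecture
    (h : ¬ _root_.Summit.NavierStokesRegularity.NavierStokesRegularity.TypeIDSSLiouvilleConjecture) :
    ¬ (∀ (M q : ℝ) (v : ℝ → EuclideanSpace ℝ (Fin 3) → EuclideanSpace ℝ (Fin 3))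
      (g : EuclideanSpace ℝ (Fin 3) → EuclideanSpace ℝ (Fin 3)), ¬ ThinObject M q v g) :=
  fun hS3 => h (typeIDSSLiouvilleConjecture_of_thinCascadeLiouville hS3)

end Summit.NavierStokesRegularity.NavierStokesRegularity.Theorems.TypeIQuantSubcubicExp.Negative

end
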